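import Literature.NumberTheory.LFunctions.WeilFinitePrimeQuadraticChar
import Summits.Ventures.WeilGRH.DualCertificateAnnihilation
import HarnessLib

/-!
# A rung of the GRH arm from a pointwise-nonnegative dual multiplier with REAL frequencies

Cell `rh-explicit`, WEIL TRACK — GRH ARM (Lean root `Summits/Ventures/WeilGRH/`, namespace
`Summit.Ventures.WeilGRH`).  FORMAT D-K of the arm's second certificate route (weil-grh-3, engine B,
`run/shared/lean/pub/rh-explicit/weil-grh-3/GRH3-ROUTE.md` §1): the kernel-checkable variant of the
dual/Bochner multiplier certificates, whose atoms are point masses `a cos(xτ) + b sin(xτ)` at REAL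
frequencies `x` (in the applications `x = k · log p₀ / D`, commensurable with the prime `p₀` of the
window, so that the prime-side ripple plus the atoms is periodic in `τ`).

The soundness step proved here ("LEMMA D-K") is elementary given the tree:

* `weilFinitePrimeQuadraticChar_nonneg_of_trigDual` — if `log (N+1) ≤ x` for every atom and
  `0 ≤ M_{χ,N}(τ) + Σ (a cos(xτ) + b sin(xτ))` for EVERY real `τ`, then `0 ≤ E_{χ,N}(g)` for every test
  function `g` supported in `[−log(N+1)/2, log(N+1)/2]`: the atoms integrate to `0` against
  `|ĝ(1/2+iτ)|²` (`integral_norm_sq_weilMellin_mul_atom_eq_zero`, `j = m = 0`), so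
  `∫ |ĝ|² M_{χ,N} = ∫ |ĝ|² (M_{χ,N} + atoms) ≥ 0`;
* `weilPositivityOnChar_of_trigDual` — hence the rung `WeilPositivityOnChar χ (log (N+1) / 2)`
  (`weilPositivityOnChar_log_succ_half_iff`), for `χ` mod `q ≠ 1`.

No multiplier constant `λ` is needed for a rung (positivity only).  The pointwise inequality is the
part a kernel checker certifies (`DualTrigKernel*.lean`).  Everything here is PROVED; no named facts.

## References

* A. Weil, *Sur les "formules explicites" de la théorie des nombres premiers* (1952), (11) and the
  «lemme» p. 262 (the hermitian functional; positivity statement).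
* E. Bombieri, *Remarks on Weil's quadratic functional in the theory of prime numbers I*, Rend. Mat.
  Acc. Lincei (9) 11 (2000), §2 (Mellin inversion on `Re s = 1/2`, used through the annihilation file).
-/

noncomputable section

open Complex Set MeasureTheory
open scoped Real

namespace Summit.Ventures.WeilGRH

open Literature.NumberTheory.LFunctions

/-- A point-mass atom of a format-D-K multiplier: `a · cos(x τ) + b · sin(x τ)` with a REAL frequency `x`
(the cosine/sine transform of the point masses at `±x` on the position side). [folklore] -/
structure TrigAtom where
  /-- frequency (position of the point mass) -/
  x : ℝ
  /-- cosine coefficient -/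
  a : ℝ
  /-- sine coefficient -/
  b : ℝ

namespace TrigAtom

/-- The value `a cos(xτ) + b sin(xτ)`. [folklore] -/
def eval (A : TrigAtom) (τ : ℝ) : ℝ :=
  A.a * Real.cos (A.x * τ) + A.b * Real.sin (A.x * τ)

/-- `|a cos(xτ) + b sin(xτ)| ≤ |a| + |b|`. [folklore] -/
theorem abs_eval_le (A : TrigAtom) (τ : ℝ) : |A.eval τ| ≤ |A.a| + |A.b| := by
  unfold eval
  calc |A.a * Real.cos (A.x * τ) + A.b * Real.sin (A.x * τ)|
      ≤ |A.a * Real.cos (A.x * τ)| + |A.b * Real.sin (A.x * τ)| := abs_add_le _ _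
    _ ≤ |A.a| + |A.b| := by
        rw [abs_mul, abs_mul]
        gcongr
        · exact mul_le_of_le_one_right (abs_nonneg _) (Real.abs_cos_le_one _)
        · exact mul_le_of_le_one_right (abs_nonneg _) (Real.abs_sin_le_one _)

/-- Continuity of `τ ↦ a cos(xτ) + b sin(xτ)`. [folklore] -/
theorem continuous_eval (A : TrigAtom) : Continuous A.eval := by
  unfold eval; fun_prop

end TrigAtom

/-- The multiplier `T(τ) = Σ_A (a_A cos(x_A τ) + b_A sin(x_A τ))` of a list of atoms. [folklore] -/
def trigSum (l : List TrigAtom) (τ : ℝ) : ℝ :=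
  (l.map fun A ↦ A.eval τ).sum

/-- [folklore] -/
@[simp] theorem trigSum_nil (τ : ℝ) : trigSum [] τ = 0 := by simp [trigSum]

/-- [folklore] -/
@[simp] theorem trigSum_cons (A : TrigAtom) (l : List TrigAtom) (τ : ℝ) :
    trigSum (A :: l) τ = A.eval τ + trigSum l τ := by simp [trigSum]

/-- Continuity of the multiplier. [folklore] -/
theorem continuous_trigSum : ∀ l : List TrigAtom, Continuous (trigSum l)
  | [] => by
      have h : trigSum [] = fun _ ↦ (0 : ℝ) := by funext τ; simp
      rw [h]; exact continuous_const
  | A :: l => by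
      have h : trigSum (A :: l) = fun τ ↦ A.eval τ + trigSum l τ := by funext τ; simp
      rw [h]; exact A.continuous_eval.add (continuous_trigSum l)

/-- `|T(τ)| ≤ Σ (|a| + |b|)`. [folklore] -/
theorem abs_trigSum_le : ∀ (l : List TrigAtom) (τ : ℝ),
    |trigSum l τ| ≤ (l.map fun A ↦ |A.a| + |A.b|).sum
  | [], τ => by simp
  | A :: l, τ => by
      rw [trigSum_cons, List.map_cons, List.sum_cons]
      exact (abs_add_le _ _).trans (add_le_add (A.abs_eval_le τ) (abs_trigSum_le l τ))

variable {g : ℝ → ℂ}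

/-- **Annihilation of the multiplier**: for `tsupport g ⊆ [-t, t]` and atoms with `2t ≤ x`,
`τ ↦ |ĝ(1/2+iτ)|² T(τ)` is integrable with integral `0`. [folklore] -/
theorem integrable_and_integral_norm_sq_weilMellin_mul_trigSum (hg : IsWeilTest g) {t : ℝ}
    (hsupp : tsupport g ⊆ Icc (-t) t) :
    ∀ l : List TrigAtom, (∀ A ∈ l, 2 * t ≤ A.x) →
      Integrable (fun τ : ℝ ↦ ‖weilMellin g (1 / 2 + τ * I)‖ ^ 2 * trigSum l τ) ∧
        (∫ τ : ℝ, ‖weilMellin g (1 / 2 + τ * I)‖ ^ 2 * trigSum l τ) = 0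
  | [], _ => by simp
  | A :: l, hx => by
      have hA : 2 * t ≤ A.x := hx A (by simp)
      obtain ⟨hil, hIl⟩ := integrable_and_integral_norm_sq_weilMellin_mul_trigSum hg hsupp l
        (fun B hB ↦ hx B (by simp [hB]))
      -- the atom `A`: annihilation with `j = m = 0`, `w = 0`
      have hann := integral_norm_sq_weilMellin_mul_atom_eq_zero hg hsupp 0 0 (w := 0) (x := A.x) le_rfl
        (by simpa using hA)
      simp only [pow_zero, one_mul] at hann
      obtain ⟨hcos, hsin⟩ := hann
      have h0 := integrable_norm_sq_weilMellin_mul_pow hg 0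
      simp only [pow_zero, mul_one] at h0
      have hic : Integrable fun τ : ℝ ↦ ‖weilMellin g (1 / 2 + τ * I)‖ ^ 2 * Real.cos (A.x * τ) :=
        h0.mul_bdd (g := fun τ : ℝ ↦ Real.cos (A.x * τ)) (c := 1) (by fun_prop)
          (ae_of_all _ fun τ ↦ by simpa using Real.abs_cos_le_one (A.x * τ))
      have his : Integrable fun τ : ℝ ↦ ‖weilMellin g (1 / 2 + τ * I)‖ ^ 2 * Real.sin (A.x * τ) :=
        h0.mul_bdd (g := fun τ : ℝ ↦ Real.sin (A.x * τ)) (c := 1) (by fun_prop)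
          (ae_of_all _ fun τ ↦ by simpa using Real.abs_sin_le_one (A.x * τ))
      have hiA : Integrable fun τ : ℝ ↦ ‖weilMellin g (1 / 2 + τ * I)‖ ^ 2 * A.eval τ := by
        have := (hic.const_mul A.a).add (his.const_mul A.b)
        refine this.congr (ae_of_all _ fun τ ↦ ?_)
        simp only [TrigAtom.eval, Pi.add_apply]
        ring
      have hIA : (∫ τ : ℝ, ‖weilMellin g (1 / 2 + τ * I)‖ ^ 2 * A.eval τ) = 0 := by
        have e : (fun τ : ℝ ↦ ‖weilMellin g (1 / 2 + τ * I)‖ ^ 2 * A.eval τ) =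
            fun τ : ℝ ↦ A.a * (‖weilMellin g (1 / 2 + τ * I)‖ ^ 2 * Real.cos (A.x * τ)) +
              A.b * (‖weilMellin g (1 / 2 + τ * I)‖ ^ 2 * Real.sin (A.x * τ)) := by
          funext τ; simp only [TrigAtom.eval]; ring
        rw [e, integral_add (hic.const_mul _) (his.const_mul _), integral_const_mul, integral_const_mul,
          hcos, hsin]
        simp
      refine ⟨?_, ?_⟩
      · have := hiA.add hil
        refine this.congr (ae_of_all _ fun τ ↦ ?_)
        simp only [trigSum_cons, Pi.add_apply]
        ring
      · have e : (fun τ : ℝ ↦ ‖weilMellin g (1 / 2 + τ * I)‖ ^ 2 * trigSum (A :: l) τ) =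
            fun τ : ℝ ↦ ‖weilMellin g (1 / 2 + τ * I)‖ ^ 2 * A.eval τ +
              ‖weilMellin g (1 / 2 + τ * I)‖ ^ 2 * trigSum l τ := by
          funext τ; rw [trigSum_cons]; ring
        rw [e, integral_add hiA hil, hIA, hIl, add_zero]

variable {q : ℕ}

/-- **LEMMA D-K (analytic form).** If every atom has frequency `x ≥ log (N+1)` and the multiplier
inequality `0 ≤ M_{χ,N}(τ) + T(τ)` holds for EVERY real `τ`, then `0 ≤ E_{χ,N}(g)` for every test function
`g` with `tsupport g ⊆ [−log(N+1)/2, log(N+1)/2]`. [folklore] -/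
theorem weilFinitePrimeQuadraticChar_nonneg_of_trigDual (χ : DirichletCharacter ℂ q) (N : ℕ)
    (l : List TrigAtom) (hx : ∀ A ∈ l, Real.log ((N : ℝ) + 1) ≤ A.x)
    (hP : ∀ τ : ℝ, 0 ≤ weilFinitePrimeWeightChar χ N τ + trigSum l τ)
    (hg : IsWeilTest g)
    (hsupp : tsupport g ⊆ Icc (-(Real.log ((N : ℝ) + 1) / 2)) (Real.log ((N : ℝ) + 1) / 2)) :
    0 ≤ weilFinitePrimeQuadraticChar χ N g := by
  set t : ℝ := Real.log ((N : ℝ) + 1) / 2 with ht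
  have hx' : ∀ A ∈ l, 2 * t ≤ A.x := fun A hA ↦ by rw [ht]; linarith [hx A hA]
  obtain ⟨hiT, hIT⟩ := integrable_and_integral_norm_sq_weilMellin_mul_trigSum hg hsupp l hx'
  have hiM := integrable_norm_sq_weilMellin_mul_weilFinitePrimeWeightChar hg χ N
  unfold weilFinitePrimeQuadraticChar
  have hsum : (∫ τ : ℝ, ‖weilMellin g (1 / 2 + τ * I)‖ ^ 2 * weilFinitePrimeWeightChar χ N τ) =
      ∫ τ : ℝ, ‖weilMellin g (1 / 2 + τ * I)‖ ^ 2 * (weilFinitePrimeWeightChar χ N τ + trigSum l τ) := by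
    have e : (fun τ : ℝ ↦ ‖weilMellin g (1 / 2 + τ * I)‖ ^ 2 *
        (weilFinitePrimeWeightChar χ N τ + trigSum l τ)) =
        fun τ : ℝ ↦ ‖weilMellin g (1 / 2 + τ * I)‖ ^ 2 * weilFinitePrimeWeightChar χ N τ +
          ‖weilMellin g (1 / 2 + τ * I)‖ ^ 2 * trigSum l τ := by
      funext τ; ring
    rw [e, integral_add hiM hiT, hIT, add_zero]
  rw [hsum]
  refine mul_nonneg (by positivity) (integral_nonneg fun τ ↦ ?_)
  exact mul_nonneg (by positivity) (hP τ)

/-- **LEMMA D-K (the rung).** For `χ` mod `q ≠ 1`: a multiplier `T = Σ (a cos(xτ) + b sin(xτ))` with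
all frequencies `x ≥ log (N+1)` and `M_{χ,N} + T ≥ 0` on `ℝ` proves the rung
`WeilPositivityOnChar χ (log (N+1) / 2)` — Weil positivity of `L(s, χ)` for all smooth `g` supported in
`[−log(N+1)/2, log(N+1)/2]`. [folklore] -/
theorem weilPositivityOnChar_of_trigDual (hq : q ≠ 1) (χ : DirichletCharacter ℂ q) (N : ℕ)
    (l : List TrigAtom) (hx : ∀ A ∈ l, Real.log ((N : ℝ) + 1) ≤ A.x)
    (hP : ∀ τ : ℝ, 0 ≤ weilFinitePrimeWeightChar χ N τ + trigSum l τ) :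
    WeilPositivityOnChar χ (Real.log ((N : ℝ) + 1) / 2) := by
  rw [weilPositivityOnChar_log_succ_half_iff hq χ N]
  intro g hg hsupp
  exact weilFinitePrimeQuadraticChar_nonneg_of_trigDual χ N l hx hP hg hsupp

end Summit.Ventures.WeilGRH

end
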